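import Summits.BirchSwinnertonDyer.BirchSwinnertonDyer.Theorems.TwoAdicConverseGoodTwistsLeafOnMinimal
import HarnessLib

/-!
# Route TwoAdicConverse — the S3 head line on each of the three (β)-ATOMS A₁ / A₂ / A₃ (proofs only)

Cell `bsd-2adic`, seat `bsd-2adic-conv-1` GEN 20 (`--supports` item stmt-BirchSwinnertonDyer-19218; nothing here closes
it).  Instances of the minimal-model engine `bsdRank_and_goldfeld_goodTwists_of_leafOnMinimal` (companion file) at the
three atoms of stratum (β) «`E(ℚ)[2] ≠ 0`», which are closed under admissible twists between minimal models
(`atom₁_twist`, `atom₂_twist`, `atom₃_twist`, file `TwoAdicConverseTwoTorsionPairTypes`):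
A₁ «`Δ < 0` with a ramified rational `2`-torsion point, or an unramified MIDDLE one» (the members of the pure pairs of
type R₁), A₂ «`Δ < 0` with an unramified point, or a ramified MIDDLE one» (mixed pairs of type M₁), A₃ «`Δ > 0` with an
EXTREME point» (the pairs of types R₂ and M₂, exchanged by negative twists).  For each: **if the `r ≤ 1` leaf holds on
the atom, then every non-CM `W` in the atom, good-ordinary or multiplicative at `2`, satisfies LADDER-BSD row S3's
head line** — rank BSD for `100 %` of `d ∈ 𝓕 = {d square-free, d ≡ 1 (mod 4)}` and Goldfeld's `50/50` with BSD in `𝓕`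
(+ GZK, Modularity, Smith's Thm 1.1 for `W`, all displayed).

HONEST FRAMING.  The atom-restricted leaves are OPEN research statements (pieces of KRR2's residual 27124 /
S3's 19218 · 24404); nothing is booked (D-0054); BSD is not proved by any of this.  PARTITION: none — RANK axis (S3) ×
the quadratic-twist axis, stratum (β).

References: A. Smith, arXiv:2503.17619, Thm 1.1 / Cor 1.2 [arXiv250317619]; R. Greenberg, LNM 1716 §5
[GreenbergLNM1716]; M. R. Murty, V. K. Murty (1997) Ch. 6 §1 [MurtyMurty1997].
-/

set_option linter.dupNamespace false
set_option autoImplicit false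

noncomputable section

open scoped Classical
open Filter Topology WeierstrassCurve Literature Literature.NumberTheory.EllipticCurves
  Literature.NumberTheory.EllipticCurves.ModularForms
  Literature.NumberTheory.EllipticCurves.Rank1Residual
  Literature.NumberTheory.EllipticCurves.Greenberg1999
  Summit.BirchSwinnertonDyer.BirchSwinnertonDyer.Theses.TwoAdicConverse

namespace Summit.BirchSwinnertonDyer.BirchSwinnertonDyer.Theorems.TwoAdicOffHabitat

variable (W : WeierstrassCurve ℚ) [W.IsElliptic] [W.IsGloballyMinimal]

/-- **The S3 head line on atom A₁** («`Δ < 0` ∧ ramified, or unramified middle»; type R₁), from the leaf on A₁.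
[cite: arXiv250317619, Thm. 1.1 and Cor. 1.2] [cite: GreenbergLNM1716, §5 Props. 5.13–5.14 and Remarks (chunks p0168–p0174)] -/
theorem bsdRank_and_goldfeld_goodTwists_of_atom₁ (hmod : exists_isNewformOf)
    (hleaf : ∀ (V : WeierstrassCurve ℚ) [V.IsElliptic] [V.IsGloballyMinimal], ¬ V.HasCM → (GoodOrd V 2 ∨ Mult V 2) →
      (∃ x : ℚ, HasRationalTwoTorsionX V x ∧ ((V.Δ < 0 ∧ TwoTorsionRamifiedAtTwo x) ∨
        (¬ TwoTorsionRamifiedAtTwo x ∧ ¬ TwoTorsionOdd V x ∧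
          ¬ ∀ r : ℝ, 4 * r ^ 3 + (V.b₂ : ℝ) * r ^ 2 + 2 * (V.b₄ : ℝ) * r + (V.b₆ : ℝ) = 0 → r ≤ (x : ℝ)))) →
      ∀ r : ℕ, r ≤ 1 → V.selmerCorank 2 = r → V.analyticRank = r)
    (hGZK : rank_eq_analyticRank_of_analyticRank_le_one) (hCM : ¬ W.HasCM) (hred : GoodOrd W 2 ∨ Mult W 2)
    (hW : ∃ x : ℚ, HasRationalTwoTorsionX W x ∧ ((W.Δ < 0 ∧ TwoTorsionRamifiedAtTwo x) ∨
      (¬ TwoTorsionRamifiedAtTwo x ∧ ¬ TwoTorsionOdd W x ∧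
        ¬ ∀ r : ℝ, 4 * r ^ 3 + (W.b₂ : ℝ) * r ^ 2 + 2 * (W.b₄ : ℝ) * r + (W.b₆ : ℝ) = 0 → r ≤ (x : ℝ))))
    (hS : smith_selmerCorank_density W) :
    Tendsto (fun X : ℕ ↦ (Nat.card {d : ℤ | Squarefree d ∧ |d| ≤ (X : ℤ) ∧ (d % 4 = 1 ∧
        ((W.quadraticTwist d).analyticRank = (W.quadraticTwist d).mordellWeilRank ∧
          Finite (W.quadraticTwist d).sha))} : ℝ) /
      Nat.card {d : ℤ | Squarefree d ∧ |d| ≤ (X : ℤ) ∧ d % 4 = 1}) atTop (𝓝 1) ∧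
    Tendsto (fun X : ℕ ↦ (Nat.card {d : ℤ | Squarefree d ∧ |d| ≤ (X : ℤ) ∧ (d % 4 = 1 ∧
        ((W.quadraticTwist d).analyticRank = 0 ∧ (W.quadraticTwist d).mordellWeilRank = 0 ∧
          Finite (W.quadraticTwist d).sha))} : ℝ) /
      Nat.card {d : ℤ | Squarefree d ∧ |d| ≤ (X : ℤ) ∧ d % 4 = 1}) atTop (𝓝 (1 / 2)) ∧
    Tendsto (fun X : ℕ ↦ (Nat.card {d : ℤ | Squarefree d ∧ |d| ≤ (X : ℤ) ∧ (d % 4 = 1 ∧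
        ((W.quadraticTwist d).analyticRank = 1 ∧ (W.quadraticTwist d).mordellWeilRank = 1 ∧
          Finite (W.quadraticTwist d).sha))} : ℝ) /
      Nat.card {d : ℤ | Squarefree d ∧ |d| ≤ (X : ℤ) ∧ d % 4 = 1}) atTop (𝓝 (1 / 2)) :=
  bsdRank_and_goldfeld_goodTwists_of_leafOnMinimal
    (fun V ↦ ∃ x : ℚ, HasRationalTwoTorsionX V x ∧ ((V.Δ < 0 ∧ TwoTorsionRamifiedAtTwo x) ∨
      (¬ TwoTorsionRamifiedAtTwo x ∧ ¬ TwoTorsionOdd V x ∧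
        ¬ ∀ r : ℝ, 4 * r ^ 3 + (V.b₂ : ℝ) * r ^ 2 + 2 * (V.b₄ : ℝ) * r + (V.b₆ : ℝ) = 0 → r ≤ (x : ℝ))))
    (fun V V' _ _ _ _ _ hd4 _ hC _ hredV hV ↦ by
      obtain ⟨x, hx, h⟩ := hV
      exact atom₁_twist hredV hx h hd4 hC)
    hleaf hGZK W hmod hCM hred hW hS

/-- **The S3 head line on atom A₂** («`Δ < 0` ∧ unramified, or ramified middle»; type M₁), from the leaf on A₂.
[cite: arXiv250317619, Thm. 1.1 and Cor. 1.2] [cite: GreenbergLNM1716, §5 Props. 5.13–5.14 and Remarks (chunks p0168–p0174)] -/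
theorem bsdRank_and_goldfeld_goodTwists_of_atom₂ (hmod : exists_isNewformOf)
    (hleaf : ∀ (V : WeierstrassCurve ℚ) [V.IsElliptic] [V.IsGloballyMinimal], ¬ V.HasCM → (GoodOrd V 2 ∨ Mult V 2) →
      (∃ x : ℚ, HasRationalTwoTorsionX V x ∧ ((V.Δ < 0 ∧ ¬ TwoTorsionRamifiedAtTwo x) ∨
        (TwoTorsionRamifiedAtTwo x ∧ ¬ TwoTorsionOdd V x ∧
          ¬ ∀ r : ℝ, 4 * r ^ 3 + (V.b₂ : ℝ) * r ^ 2 + 2 * (V.b₄ : ℝ) * r + (V.b₆ : ℝ) = 0 → r ≤ (x : ℝ)))) →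
      ∀ r : ℕ, r ≤ 1 → V.selmerCorank 2 = r → V.analyticRank = r)
    (hGZK : rank_eq_analyticRank_of_analyticRank_le_one) (hCM : ¬ W.HasCM) (hred : GoodOrd W 2 ∨ Mult W 2)
    (hW : ∃ x : ℚ, HasRationalTwoTorsionX W x ∧ ((W.Δ < 0 ∧ ¬ TwoTorsionRamifiedAtTwo x) ∨
      (TwoTorsionRamifiedAtTwo x ∧ ¬ TwoTorsionOdd W x ∧
        ¬ ∀ r : ℝ, 4 * r ^ 3 + (W.b₂ : ℝ) * r ^ 2 + 2 * (W.b₄ : ℝ) * r + (W.b₆ : ℝ) = 0 → r ≤ (x : ℝ))))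
    (hS : smith_selmerCorank_density W) :
    Tendsto (fun X : ℕ ↦ (Nat.card {d : ℤ | Squarefree d ∧ |d| ≤ (X : ℤ) ∧ (d % 4 = 1 ∧
        ((W.quadraticTwist d).analyticRank = (W.quadraticTwist d).mordellWeilRank ∧
          Finite (W.quadraticTwist d).sha))} : ℝ) /
      Nat.card {d : ℤ | Squarefree d ∧ |d| ≤ (X : ℤ) ∧ d % 4 = 1}) atTop (𝓝 1) ∧
    Tendsto (fun X : ℕ ↦ (Nat.card {d : ℤ | Squarefree d ∧ |d| ≤ (X : ℤ) ∧ (d % 4 = 1 ∧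
        ((W.quadraticTwist d).analyticRank = 0 ∧ (W.quadraticTwist d).mordellWeilRank = 0 ∧
          Finite (W.quadraticTwist d).sha))} : ℝ) /
      Nat.card {d : ℤ | Squarefree d ∧ |d| ≤ (X : ℤ) ∧ d % 4 = 1}) atTop (𝓝 (1 / 2)) ∧
    Tendsto (fun X : ℕ ↦ (Nat.card {d : ℤ | Squarefree d ∧ |d| ≤ (X : ℤ) ∧ (d % 4 = 1 ∧
        ((W.quadraticTwist d).analyticRank = 1 ∧ (W.quadraticTwist d).mordellWeilRank = 1 ∧
          Finite (W.quadraticTwist d).sha))} : ℝ) /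
      Nat.card {d : ℤ | Squarefree d ∧ |d| ≤ (X : ℤ) ∧ d % 4 = 1}) atTop (𝓝 (1 / 2)) :=
  bsdRank_and_goldfeld_goodTwists_of_leafOnMinimal
    (fun V ↦ ∃ x : ℚ, HasRationalTwoTorsionX V x ∧ ((V.Δ < 0 ∧ ¬ TwoTorsionRamifiedAtTwo x) ∨
      (TwoTorsionRamifiedAtTwo x ∧ ¬ TwoTorsionOdd V x ∧
        ¬ ∀ r : ℝ, 4 * r ^ 3 + (V.b₂ : ℝ) * r ^ 2 + 2 * (V.b₄ : ℝ) * r + (V.b₆ : ℝ) = 0 → r ≤ (x : ℝ))))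
    (fun V V' _ _ _ _ _ hd4 _ hC _ hredV hV ↦ by
      obtain ⟨x, hx, h⟩ := hV
      exact atom₂_twist hredV hx h hd4 hC)
    hleaf hGZK W hmod hCM hred hW hS

/-- **The S3 head line on atom A₃** («`Δ > 0` with an extreme point»; types R₂/M₂), from the leaf on A₃.
[cite: arXiv250317619, Thm. 1.1 and Cor. 1.2] [cite: GreenbergLNM1716, §5 Props. 5.13–5.14 and Remarks (chunks p0168–p0174)] -/
theorem bsdRank_and_goldfeld_goodTwists_of_atom₃ (hmod : exists_isNewformOf)
    (hleaf : ∀ (V : WeierstrassCurve ℚ) [V.IsElliptic] [V.IsGloballyMinimal], ¬ V.HasCM → (GoodOrd V 2 ∨ Mult V 2) →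
      (∃ x : ℚ, HasRationalTwoTorsionX V x ∧ 0 < V.Δ ∧ (TwoTorsionOdd V x ∨
          ∀ r : ℝ, 4 * r ^ 3 + (V.b₂ : ℝ) * r ^ 2 + 2 * (V.b₄ : ℝ) * r + (V.b₆ : ℝ) = 0 → r ≤ (x : ℝ))) →
      ∀ r : ℕ, r ≤ 1 → V.selmerCorank 2 = r → V.analyticRank = r)
    (hGZK : rank_eq_analyticRank_of_analyticRank_le_one) (hCM : ¬ W.HasCM) (hred : GoodOrd W 2 ∨ Mult W 2)
    (hW : ∃ x : ℚ, HasRationalTwoTorsionX W x ∧ 0 < W.Δ ∧ (TwoTorsionOdd W x ∨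
        ∀ r : ℝ, 4 * r ^ 3 + (W.b₂ : ℝ) * r ^ 2 + 2 * (W.b₄ : ℝ) * r + (W.b₆ : ℝ) = 0 → r ≤ (x : ℝ)))
    (hS : smith_selmerCorank_density W) :
    Tendsto (fun X : ℕ ↦ (Nat.card {d : ℤ | Squarefree d ∧ |d| ≤ (X : ℤ) ∧ (d % 4 = 1 ∧
        ((W.quadraticTwist d).analyticRank = (W.quadraticTwist d).mordellWeilRank ∧
          Finite (W.quadraticTwist d).sha))} : ℝ) /
      Nat.card {d : ℤ | Squarefree d ∧ |d| ≤ (X : ℤ) ∧ d % 4 = 1}) atTop (𝓝 1) ∧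
    Tendsto (fun X : ℕ ↦ (Nat.card {d : ℤ | Squarefree d ∧ |d| ≤ (X : ℤ) ∧ (d % 4 = 1 ∧
        ((W.quadraticTwist d).analyticRank = 0 ∧ (W.quadraticTwist d).mordellWeilRank = 0 ∧
          Finite (W.quadraticTwist d).sha))} : ℝ) /
      Nat.card {d : ℤ | Squarefree d ∧ |d| ≤ (X : ℤ) ∧ d % 4 = 1}) atTop (𝓝 (1 / 2)) ∧
    Tendsto (fun X : ℕ ↦ (Nat.card {d : ℤ | Squarefree d ∧ |d| ≤ (X : ℤ) ∧ (d % 4 = 1 ∧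
        ((W.quadraticTwist d).analyticRank = 1 ∧ (W.quadraticTwist d).mordellWeilRank = 1 ∧
          Finite (W.quadraticTwist d).sha))} : ℝ) /
      Nat.card {d : ℤ | Squarefree d ∧ |d| ≤ (X : ℤ) ∧ d % 4 = 1}) atTop (𝓝 (1 / 2)) :=
  bsdRank_and_goldfeld_goodTwists_of_leafOnMinimal
    (fun V ↦ ∃ x : ℚ, HasRationalTwoTorsionX V x ∧ 0 < V.Δ ∧ (TwoTorsionOdd V x ∨
        ∀ r : ℝ, 4 * r ^ 3 + (V.b₂ : ℝ) * r ^ 2 + 2 * (V.b₄ : ℝ) * r + (V.b₆ : ℝ) = 0 → r ≤ (x : ℝ)))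
    (fun V V' _ _ _ _ _ hd4 _ hC _ _ hV ↦ by
      obtain ⟨x, hx, h⟩ := hV
      exact atom₃_twist hx h hd4 hC)
    hleaf hGZK W hmod hCM hred hW hS

end Summit.BirchSwinnertonDyer.BirchSwinnertonDyer.Theorems.TwoAdicOffHabitat

end
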